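import Mathlib
import HarnessLib
import Summits.HubbardSuperconductivity.HubbardSuperconductivity.Theorems.KLProgrammeC4aPartnerBandCritical
import Summits.HubbardSuperconductivity.HubbardSuperconductivity.Theorems.KLProgrammeC4aRadialRowOne
import Summits.HubbardSuperconductivity.HubbardSuperconductivity.Theorems.KLProgrammeKLRegimeSplitPredicates
import Summits.HubbardSuperconductivity.HubbardSuperconductivity.Theorems.KLProgrammeDispersionFlowEnvelope

/-!
# Route `KLProgramme` — crux C4a, S3 brick (B2, TANGENCY, CURVATURE FLOOR): the curvature coefficient `b_T(θ) = D²e_K(Φ(0,θ))[∂_sΦ, ∂_sΦ]` of the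
# tangency expansion is bounded BELOW by the frame's tangential-Hessian constant — `b_T(θ) ≥ w_min·‖∂_sΦ(0,θ)‖² ≥ w_min·u_min²`

Cell `gate-hubbard-kl`, lane hubbard-kl-c4a-1 (g6); helper for stub (C) `stub_twoLeg_curvature` of the engine-flow child `KLRegimeEngineV17F2`
(stmt-HubbardSuperconductivity-20437); memo HOME/hubbard-kl-c4a-1/C4A-PLAN.md §24.8 (i).  `…C4aTangencyCurvature` identifies the coefficient of `φ²` in the partner band at the
tangency configuration as `b_T(θ) = D²e_K(Φ(0,θ))[Φ′(0,θ), Φ′(0,θ)]`.  The engine's frame hypothesis `FrameOK R U N μ K` carries FST II's geometric constants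
`GeomConstants e_K 7 (3/80) (1/2) (3/200)` (`…KLRegimeSplitPredicates`), whose `le_hessQuad` field is exactly the tangential-Hessian floor `(t, e_K″ t) ≥ w_min|t|²` for
`t ⊥ ∇e_K` on `{|e_K| < r₀}`; at `p = Φ(0,θ)` (`e_K = 0`) the tangent `Φ′(0,θ)` is such a `t` (`fderiv_frameLevel_deriv_levelPoint_angle`), and `‖Φ′‖ ≥ ‖Φ‖ = u ≥ u_min`.

* `norm_toLp_frame_comb_sq` (`‖a·dir s + b·dir(s+π/2)‖² = a² + b²`), `norm_levelPoint_le_norm_iteratedDeriv_one` (`‖Φ(ρ,s)‖ ≤ ‖∂_sΦ(ρ,s)‖`), `umin_le_frameRadius`;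
* **`curvCoeff_ge_of_geomConstants`** (`w_min‖Φ′(0,θ)‖² ≤ b_T(θ)`), **`curvCoeff_ge_of_frameOK`** (`(3/200)·‖Φ′(0,θ)‖² ≤ b_T(θ)`), `curvCoeff_ge_umin_sq_of_frameOK`.

Bookkeeping on landed objects; nothing about the model's sizes; nothing asserts superconductivity.  References: FST II CPAM 51 (1998) Lemma 2.1 [cite: FeldmanSalmhoferTrubowitz1998];
BGM 2006 §2.4 [cite: BenfattoGiulianiMastropietro2006].
-/

noncomputable section

namespace Summit.HubbardSuperconductivity.HubbardSuperconductivity.Theorems.C4a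

set_option linter.dupNamespace false -- summit = problem name (single-conjunct summit), D-0017

open Real Set Filter
open scoped Topology InnerProductSpace
open Literature.MathematicalPhysics.QuantumLattice Literature.MathematicalPhysics.QuantumLattice.BandSectorCounting Literature.Probability.LatticeModels
open Literature.MathematicalPhysics.QuantumLattice.FermiRG
open Summit.HubbardSuperconductivity.HubbardSuperconductivity.Theorems.KLRegimeSplit
open Summit.HubbardSuperconductivity.HubbardSuperconductivity.Theorems.DispersionFlow
open Summit.HubbardSuperconductivity.HubbardSuperconductivity.Theorems.PerturbedFermiCurve

/-! ## §1 The moving frame is orthonormal in the Euclidean norm -/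

/-- `‖toLp(a·dir s + b·dir(s + π/2))‖² = a² + b²` in `Momentum = EuclideanSpace ℝ (Fin 2)`. [folklore] -/
theorem norm_toLp_frame_comb_sq (a b s : ℝ) : ‖(WithLp.toLp 2 (a • dir s + b • dir (s + π / 2)) : Momentum)‖ ^ 2 = a ^ 2 + b ^ 2 := by
  rw [EuclideanSpace.real_norm_sq_eq, Fin.sum_univ_two]
  simp only [Pi.add_apply, Pi.smul_apply, smul_eq_mul, dir, Matrix.cons_val_zero, Matrix.cons_val_one,
    Real.cos_add_pi_div_two, Real.sin_add_pi_div_two]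
  linear_combination (a ^ 2 + b ^ 2) * Real.sin_sq_add_cos_sq s

/-- `|b| ≤ ‖toLp(a·dir s + b·dir(s + π/2))‖`. [folklore] -/
theorem abs_le_norm_toLp_frame_comb (a b s : ℝ) : |b| ≤ ‖(WithLp.toLp 2 (a • dir s + b • dir (s + π / 2)) : Momentum)‖ := by
  have h := norm_toLp_frame_comb_sq a b s
  exact abs_le_of_sq_le_sq' (by nlinarith [sq_nonneg a, sq_abs b]) (norm_nonneg _) |>.2

section Band

variable {a b : ℝ} (B : BandBounds a b) {K : TrigPolyC4v} {A : ℝ} (hA : ∀ p : Momentum, ∀ j ≤ 2, ‖iteratedFDeriv ℝ j (frameShift K) p‖ ≤ A)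
include B hA

/-- **The frame's radius is at least the table's `u_min`**: `u_min ≤ u₀(ν − A; s) ≤ u_K(ν; s)` for `[ν − A, ν + A] ⊂ [a, b]`. [cite: BenfattoGiulianiMastropietro2006, §2.4 (2.40)] -/
theorem umin_le_frameRadius {ν : ℝ} (hlo : a ≤ ν - A) (hhi : ν + A ≤ b) (s : ℝ) :
    B.umin ≤ perturbedFermiRadius (fun p : Fin 2 → ℝ => -K.eval p) ν s := by
  have hA0 : 0 ≤ A := (norm_nonneg _).trans (hA 0 0 (by norm_num))
  exact (B.umin_le (ν - A) ⟨hlo, by linarith⟩ s).trans (bandFermiRadius_le_perturbedFermiRadius_le B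
    (by rw [← frameShift_toLp_eq_neg_eval]; exact continuous_frameShift_toLp K) (abs_neg_eval_le_of_frameSize hA) hlo hhi s).1

end Band

section Sizes

variable {K : TrigPolyC4v} {A : ℝ} (hA : ∀ p : Momentum, ∀ j ≤ 2, ‖iteratedFDeriv ℝ j (frameShift K) p‖ ≤ A)
  (hd : klCurveD ≤ (bandBounds (show (-4 : ℝ) < -1.1 by norm_num) (show (-1.1 : ℝ) ≤ -0.1 by norm_num)
    (show (-0.1 : ℝ) < 0 by norm_num)).Dtmin - 2 * A)
  {μ r : ℝ} (hr : 0 < r) (hlo : (-1.1 : ℝ) < μ - r - A) (hhi : μ + r + A < -0.1)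
include hA hd hr hlo hhi

omit hr in
/-- **`‖Φ(ρ,s)‖ ≤ ‖∂_sΦ(ρ,s)‖`**: the tangent `u′·dir s + u·dir(s+π/2)` of a polar curve is at least as long as the radius `u = ‖Φ‖`. -/
theorem norm_levelPoint_le_norm_iteratedDeriv_one {ρ : ℝ} (hρ : |ρ| < r) (s : ℝ) :
    ‖levelPoint μ K ρ s‖ ≤ ‖iteratedDeriv 1 (levelPoint μ K ρ) s‖ := by
  set B₀ := bandBounds (show (-4 : ℝ) < -1.1 by norm_num) (show (-1.1 : ℝ) ≤ -0.1 by norm_num) (show (-0.1 : ℝ) < 0 by norm_num) with hB₀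
  have hADt : 2 * A < B₀.Dtmin := by have := klCurveD_pos; linarith
  have h1 := (abs_lt.1 hρ).1
  have h2 := (abs_lt.1 hρ).2
  have hl : (-1.1 : ℝ) ≤ μ + ρ - A := by linarith
  have hh : μ + ρ + A ≤ -0.1 := by linarith
  rw [iteratedDeriv_one_levelPoint hA hd hl hh s, norm_levelPoint B₀ hA (by linarith) (by linarith) s]
  refine le_trans (le_abs_self _) (abs_le_norm_toLp_frame_comb _ _ s)

omit hr in
/-- **`u_min ≤ ‖∂_sΦ(ρ,s)‖`** on the tube of the window of record (`u_min` of `bandBounds (-1.1) (-0.1)`). -/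
theorem umin_le_norm_iteratedDeriv_one_levelPoint {ρ : ℝ} (hρ : |ρ| < r) (s : ℝ) :
    (bandBounds (show (-4 : ℝ) < -1.1 by norm_num) (show (-1.1 : ℝ) ≤ -0.1 by norm_num) (show (-0.1 : ℝ) < 0 by norm_num)).umin ≤
      ‖iteratedDeriv 1 (levelPoint μ K ρ) s‖ := by
  set B₀ := bandBounds (show (-4 : ℝ) < -1.1 by norm_num) (show (-1.1 : ℝ) ≤ -0.1 by norm_num) (show (-0.1 : ℝ) < 0 by norm_num) with hB₀
  have hADt : 2 * A < B₀.Dtmin := by have := klCurveD_pos; linarith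
  have h1 := (abs_lt.1 hρ).1
  have h2 := (abs_lt.1 hρ).2
  refine le_trans ?_ (norm_levelPoint_le_norm_iteratedDeriv_one hA hd hlo hhi hρ s)
  rw [norm_levelPoint B₀ hA (by linarith) (by linarith) s]
  exact umin_le_frameRadius B₀ hA (ν := μ + ρ) (by linarith) (by linarith) s

/-- **THE CURVATURE FLOOR from FST II's geometric constants**: if `e_K` has `GeomConstants e_K Kc r₀ g₀ w_min`, then for every base angle `θ`
`w_min·‖∂_sΦ(0,θ)‖² ≤ b_T(θ) = D²e_K(Φ(0,θ))[∂_sΦ(0,θ), ∂_sΦ(0,θ)]` (the tangent is `⊥ ∇e_K` because `e_K ∘ Φ(0,·) ≡ 0`). [cite: FeldmanSalmhoferTrubowitz1998, Lemma 2.1] -/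
theorem curvCoeff_ge_of_geomConstants {Kc r₀ g₀ wmin : ℝ} (hG : GeomConstants (frameLevel μ K) Kc r₀ g₀ wmin) (θ : ℝ) :
    wmin * ‖iteratedDeriv 1 (levelPoint μ K 0) θ‖ ^ 2 ≤
      fderiv ℝ (fderiv ℝ (frameLevel μ K)) (levelPoint μ K 0 θ) (iteratedDeriv 1 (levelPoint μ K 0) θ) (iteratedDeriv 1 (levelPoint μ K 0) θ) := by
  set B₀ := bandBounds (show (-4 : ℝ) < -1.1 by norm_num) (show (-1.1 : ℝ) ≤ -0.1 by norm_num) (show (-0.1 : ℝ) < 0 by norm_num) with hB₀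
  have hADt : 2 * A < B₀.Dtmin := by have := klCurveD_pos; linarith
  rw [← hessQuad_eq_fderiv_fderiv]
  refine hG.le_hessQuad _ ?_ _ ?_
  · rw [frameLevel_levelPoint_zero B₀ hA hr hlo hhi θ, abs_zero]; exact hG.r₀_pos
  · rw [inner_gradient_left, iteratedDeriv_one]
    exact fderiv_frameLevel_deriv_levelPoint_angle B₀ hA hADt hr hlo hhi θ

/-- **THE CURVATURE FLOOR under `FrameOK`**: `(3/200)·‖∂_sΦ(0,θ)‖² ≤ b_T(θ)`. -/
theorem curvCoeff_ge_of_frameOK {R : RenConsts} {U : ℝ} {N : ℕ} (hF : FrameOK R U N μ K) (θ : ℝ) :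
    3 / 200 * ‖iteratedDeriv 1 (levelPoint μ K 0) θ‖ ^ 2 ≤
      fderiv ℝ (fderiv ℝ (frameLevel μ K)) (levelPoint μ K 0 θ) (iteratedDeriv 1 (levelPoint μ K 0) θ) (iteratedDeriv 1 (levelPoint μ K 0) θ) :=
  curvCoeff_ge_of_geomConstants hA hd hr hlo hhi hF.1 θ

/-- **THE CURVATURE FLOOR, numeric form**: `(3/200)·u_min² ≤ b_T(θ)` under `FrameOK` (`u_min` of `bandBounds (-1.1) (-0.1)`). -/
theorem curvCoeff_ge_umin_sq_of_frameOK {R : RenConsts} {U : ℝ} {N : ℕ} (hF : FrameOK R U N μ K) (θ : ℝ) :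
    3 / 200 * (bandBounds (show (-4 : ℝ) < -1.1 by norm_num) (show (-1.1 : ℝ) ≤ -0.1 by norm_num) (show (-0.1 : ℝ) < 0 by norm_num)).umin ^ 2 ≤
      fderiv ℝ (fderiv ℝ (frameLevel μ K)) (levelPoint μ K 0 θ) (iteratedDeriv 1 (levelPoint μ K 0) θ) (iteratedDeriv 1 (levelPoint μ K 0) θ) := by
  have h0 : |(0 : ℝ)| < r := by simpa using hr
  have hu := umin_le_norm_iteratedDeriv_one_levelPoint hA hd hlo hhi h0 θ
  have hpos := (bandBounds (show (-4 : ℝ) < -1.1 by norm_num) (show (-1.1 : ℝ) ≤ -0.1 by norm_num) (show (-0.1 : ℝ) < 0 by norm_num)).umin_pos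
  refine le_trans ?_ (curvCoeff_ge_of_frameOK hA hd hr hlo hhi hF θ)
  gcongr

end Sizes

end Summit.HubbardSuperconductivity.HubbardSuperconductivity.Theorems.C4a

end
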